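import Summits.AtomisticToContinuum.Crystallization.Theorems.FrustratedLawDichotomyAveragingRuleTightFree

/-!
# FrustratedLawDichotomy · the UNSPLIT averaging feed: crux ⟸ Door ∧ SF₄₅ ∧ UP ∧ ONE finite `C`-free motif family (no elastic piece)

`…AveragingRuleCap` / `…AveragingRuleTightFree` (hand-2 g13, p829695 / p829756) feed the SPLIT Schur cut: `T′♭₄₅ ⟸ LAP^D on motifs`, with
`E′♭₄₅` kept as a separate hypothesis (or its own averaging family, `…AveragingRuleE`).  lens-5 g34's UNSPLIT cut needs no elastic piece at
all: `FRG♭ = SchurRangeGap w ω A e₁ C` (`e₁·N − C·#tightly-good ≤ Σ W − A·N`) at any level `e₁ > eUp` gives `FDG` and the crux directly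
(`…SchurCutB.aperiodicFrustratedLawGap_of_schurCut`; literal `e₁ = −0.7174`, MEASURED TRUE-type-indicated ×1.97 / ×2.86, `…SchurCut` §5).
`FRG♭` is `T′♭` with ZERO surcharge (`κ_T = 0`, `schurRangeGap_of_topological_zero`), so the whole averaging apparatus applies verbatim:

* §1 `schurRangeGap_of_ballAveragedMotifCap₀` — `FRG♭(e₁, C) ⟸ LAP^D_ρ on radius-ϱ motifs at level e₁ + A with κ_T = 0`;
  crux BY NAME WITHOUT `E′♭`: `aperiodicFrustratedLawGap_of_ballAveragedMotifCap_unsplit` (generic), ★ `…_fourHalf_…_unsplit`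
  (`W₄₅`, level `−0.7174 + 3/400`), and the periodic sibling `periodicFrustratedLawGap_fourHalf_of_ballAveragedMotifCap` (stmt-27624).
* §2 tight absorption at a general surcharge `0 ≤ κ_T ≤ 1` (`tightAbsorptionCapAt`, PROVED; `C` eliminated for `C ≥ C_T⁰(R,B,e,ρ)`) and the
  `C`-free family `TightFreeMotifPricingCapAt κ_T ρ ϱ D W e` («every injective `7/10`-separated radius-`ϱ` motif whose centre's `ρ`-ball holds no
  capped-tightly-good site has `S^D_centre(C = 0) ≥ 0`»; `…At (1/100) = TightFreeMotifPricingCap` of `…TightFree`);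
  `ballAveragedMotifPricingCap_of_tightFreeAt`.
* §3 ★★ `aperiodicFrustratedLawGap_fourHalf_of_tightFreeMotifCap_unsplit` —
  `MuEquilibriumDoor ∧ SF₄₅ ∧ UP(−0.7175) ∧ TightFreeMotifPricingCapAt 0 ρ ϱ D W₄₅ (−0.7174 + 3/400) ⟹ AperiodicFrustratedLawGap`
  (`0 ≤ ρ ≤ ρ₁`, `9/2 ≤ ρ₁`, `13/10·D + 1 ≤ ρ₁`, `ρ + ρ₁ ≤ ϱ`; one-shell literal `…_oneShell`) and the same for stmt-27624.  THE FEED OF COLUMN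
  27623 THROUGH THE FLAT RULE, SHORTEST FORM: door (PROVED) ∧ `SF₄₅` (KNOWN·CERTIFIED, hand-1's radial certificates) ∧ `UP` (tree number,
  computational leaf) ∧ ONE finite-size family of `C`-free tight-free motif inequalities at level `−0.7174 + 3/400` (no surcharge, no elastic piece).
  Price: the strained-patch members (`F1`) must clear `−0.7174` instead of `−0.7175` (`10⁻⁴` of a measured `2.4·10⁻³` margin); the defect-core
  members (`F2`) are WEAKER than in the split (no `1/100` surcharge to finance).

[folklore] bookkeeping; 0 sorry.  Prover hand 2, gen 13 (decomp-a2c), `--supports stmt-AtomisticToContinuum-27623`.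
-/

noncomputable section

namespace Summit.AtomisticToContinuum.Crystallization.Theorems.FrustratedLawDichotomyAveragingRuleUnsplit

open scoped BigOperators Classical
open Literature.MathematicalPhysics.StatisticalMechanics (interactionEnergy siteEnergy)
open Summit.AtomisticToContinuum.Crystallization.Theorems.ChargedEnergyGapNegative (E3)
open Summit.AtomisticToContinuum.Crystallization.Theorems.FrustratedLawDichotomyRangeCut
open Summit.AtomisticToContinuum.Crystallization.Theorems.FrustratedLawDichotomySchurCut
open Summit.AtomisticToContinuum.Crystallization.Theorems.FrustratedLawDichotomyLocalDischargingRule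
open Summit.AtomisticToContinuum.Crystallization.Theorems.FrustratedLawDichotomyMotifLemmas
open Summit.AtomisticToContinuum.Crystallization.Theorems.FrustratedLawDichotomyRuleToolkit
open Summit.AtomisticToContinuum.Crystallization.Theorems.FrustratedLawDichotomyRuleToolkitGood
open Summit.AtomisticToContinuum.Crystallization.Theorems.FrustratedLawDichotomyAveragingCut
  (ball ballAvg mem_ball card_ball_pos one_le_card_ball card_ball_le CutBounds Mball one_le_Mball Dfl Dfl_pos CT₀ Dfl_le_CT₀ siteEnergy_ge
   sum_div_ge_of_one_large W₄₅_cutBounds W₅_cutBounds)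
open Summit.AtomisticToContinuum.Crystallization.Theorems.FrustratedLawDichotomyAveragingRule
open Summit.AtomisticToContinuum.Crystallization.Theorems.FrustratedLawDichotomyAveragingRuleCap
open Summit.AtomisticToContinuum.Crystallization.Theorems.FrustratedLawDichotomyAveragingRuleTightFree

/-! ## §1. Zero surcharge: `FRG♭` from `LAP^D` on motifs, and the crux without the elastic piece -/

/-- `FRG♭(e₁, C)` IS `T′♭` at level `e₁` with zero surcharge `κ_T = 0` and allowance `C`. [folklore] -/
theorem schurRangeGap_of_topological_zero {η₁ : ℝ} {w ω : ℝ → ℝ} {A e₁ C : ℝ} (h : SchurTopologicalPricing (1 / 20) η₁ w ω A e₁ 0 C) :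
    SchurRangeGap w ω A e₁ C := by
  intro N y hy hsep
  have h1 := h N y hy hsep
  linarith

/-- ★ **`FRG♭(e₁, C) ⟸ LAP^D_ρ on radius-ϱ motifs at level `e₁ + A`, surcharge `0`, allowance `C ≥ 0`** (Schur cut whose `effPot` vanishes from
`R` on; `0 ≤ ρ ≤ ρ₁`, `R ≤ ρ₁`, `13/10·D + 1 ≤ ρ₁`, `ρ + ρ₁ ≤ ϱ`, `η₁ ≤ 3/10`). [folklore chaining] -/
theorem schurRangeGap_of_ballAveragedMotifCap₀ {η₁ D A e₁ C R ρ ρ₁ ϱ : ℝ} {w ω : ℝ → ℝ} (hW : ∀ r, R ≤ r → effPot w ω A r = 0)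
    (hη₁ : η₁ ≤ 3 / 10) (h0 : 0 ≤ ρ) (hρ : ρ ≤ ρ₁) (hR : R ≤ ρ₁) (hD : 13 / 10 * D + 1 ≤ ρ₁) (hϱ : ρ + ρ₁ ≤ ϱ) (hC : 0 ≤ C)
    (h : BallAveragedMotifPricingCap ρ ϱ (1 / 20) η₁ D (effPot w ω A) (e₁ + A) 0 C) : SchurRangeGap w ω A e₁ C :=
  schurRangeGap_of_topological_zero
    (schurTopologicalPricing_of_ballAveragedMotifCap hW (by norm_num) hη₁ h0 hρ hR hD hϱ le_rfl hC h)

/-- ★ **The crux WITHOUT the elastic piece** (generic): `MuEquilibriumDoor ∧ SF ∧ UP(eUp) ∧ (eUp < e₁) ∧ LAP^D on motifs at (e₁ + A, 0, C)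
⟹ AperiodicFrustratedLawGap`. [folklore chaining] -/
theorem aperiodicFrustratedLawGap_of_ballAveragedMotifCap_unsplit {η₁ D A eUp e₁ C R ρ ρ₁ ϱ : ℝ} {w ω : ℝ → ℝ}
    (hDoor : Summit.AtomisticToContinuum.Crystallization.Theses.GrainCoreNetworkSplit.MuEquilibriumDoor)
    (hSF : SchurFloor w ω A) (hU : PeriodicEnergyCeiling eUp) (he : eUp < e₁)
    (hW : ∀ r, R ≤ r → effPot w ω A r = 0) (hη₁ : η₁ ≤ 3 / 10) (h0 : 0 ≤ ρ) (hρ : ρ ≤ ρ₁) (hR : R ≤ ρ₁) (hD : 13 / 10 * D + 1 ≤ ρ₁)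
    (hϱ : ρ + ρ₁ ≤ ϱ) (hC : 0 ≤ C) (h : BallAveragedMotifPricingCap ρ ϱ (1 / 20) η₁ D (effPot w ω A) (e₁ + A) 0 C) :
    Summit.AtomisticToContinuum.Crystallization.Theses.FrustratedLawDichotomy.AperiodicFrustratedLawGap :=
  aperiodicFrustratedLawGap_of_schurCut hDoor hSF hU (schurRangeGap_of_ballAveragedMotifCap₀ hW hη₁ h0 hρ hR hD hϱ hC h) he

/-- ★ **Record node, unsplit**: `MuEquilibriumDoor ∧ SF₄₅ ∧ UP(−0.7175) ∧ LAP^D on radius-ϱ motifs for W₄₅ at level −0.7174 + 3/400, surcharge 0,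
allowance C ⟹ AperiodicFrustratedLawGap` (`0 ≤ ρ ≤ ρ₁`, `9/2 ≤ ρ₁`, `13/10·D + 1 ≤ ρ₁`, `ρ + ρ₁ ≤ ϱ`, `0 ≤ C`). [folklore chaining] -/
theorem aperiodicFrustratedLawGap_fourHalf_of_ballAveragedMotifCap_unsplit {C D ρ ρ₁ ϱ : ℝ}
    (hDoor : Summit.AtomisticToContinuum.Crystallization.Theses.GrainCoreNetworkSplit.MuEquilibriumDoor)
    (hSF : SF₄₅) (hU : PeriodicEnergyCeiling (-(7175 / 10000)))
    (h0 : 0 ≤ ρ) (hρ : ρ ≤ ρ₁) (hR : 9 / 2 ≤ ρ₁) (hD : 13 / 10 * D + 1 ≤ ρ₁) (hϱ : ρ + ρ₁ ≤ ϱ) (hC : 0 ≤ C)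
    (h : BallAveragedMotifPricingCap ρ ϱ (1 / 20) (1 / 8) D (effPot w₄₅ ω₄ (3 / 400)) (-(7174 / 10000) + 3 / 400) 0 C) :
    Summit.AtomisticToContinuum.Crystallization.Theses.FrustratedLawDichotomy.AperiodicFrustratedLawGap :=
  aperiodicFrustratedLawGap_of_ballAveragedMotifCap_unsplit hDoor hSF hU (by norm_num) (fun _ hr => effPot_fourHalf_eq_zero _ hr) (by norm_num)
    h0 hρ hR hD hϱ hC h

/-- **The periodic sibling `PeriodicFrustratedLawGap` (stmt-27624) at the record node from the same family.** [folklore chaining] -/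
theorem periodicFrustratedLawGap_fourHalf_of_ballAveragedMotifCap {C D ρ ρ₁ ϱ : ℝ}
    (hDoor : Summit.AtomisticToContinuum.Crystallization.Theses.GrainCoreNetworkSplit.MuEquilibriumDoor)
    (hSF : SF₄₅) (hU : PeriodicEnergyCeiling (-(7175 / 10000)))
    (h0 : 0 ≤ ρ) (hρ : ρ ≤ ρ₁) (hR : 9 / 2 ≤ ρ₁) (hD : 13 / 10 * D + 1 ≤ ρ₁) (hϱ : ρ + ρ₁ ≤ ϱ) (hC : 0 ≤ C)
    (h : BallAveragedMotifPricingCap ρ ϱ (1 / 20) (1 / 8) D (effPot w₄₅ ω₄ (3 / 400)) (-(7174 / 10000) + 3 / 400) 0 C) :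
    Summit.AtomisticToContinuum.Crystallization.Theses.FrustratedLawDichotomy.PeriodicFrustratedLawGap :=
  periodicFrustratedLawGap_of_schurCut hDoor hSF hU
    (schurRangeGap_of_ballAveragedMotifCap₀ (fun _ hr => effPot_fourHalf_eq_zero _ hr) (by norm_num) h0 hρ hR hD hϱ hC h) (by norm_num)

/-! ## §2. Tight absorption at a general surcharge `0 ≤ κ_T ≤ 1`, and the `C`-free family -/

/-- Capped surplus floor at a general surcharge `0 ≤ κ_T ≤ 1` (`C ≥ 0`). [folklore] -/
theorem surplusCap_ge_at {W : ℝ → ℝ} {R B e κT CT D : ℝ} (hW : CutBounds W R B) (hκ0 : 0 ≤ κT) (hκ1 : κT ≤ 1) (hCT : 0 ≤ CT)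
    {N : ℕ} {y : Fin N → E3} (hs : Sep y) (j : Fin N) : -Dfl R B e ≤ surplusCap (1 / 20) (1 / 8) D W e κT CT N y j := by
  have h := siteEnergy_ge hW hs j
  have hsite : (pairSumFeature W N y j - W 0) / 2 = siteEnergy W y j / 2 := by
    unfold pairSumFeature; rw [siteEnergy_eq]
  unfold surplusCap
  rw [hsite]
  unfold Dfl
  have hg1 := goodFlag_mem (η := 1 / 8) (D := D) y j
  have hg0 := goodFlag_mem (η := 1 / 20) (D := D) y j
  have h3 : κT * (1 - goodFlag (1 / 8) D N y j) ≤ 1 := by nlinarith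
  nlinarith [le_abs_self e, mul_nonneg hCT hg0.1]

/-- Capped tight surplus at a general surcharge: a capped-tightly-good site carries `x^D_j(C) ≥ C − Dfl`. [folklore] -/
theorem surplusCap_ge_of_good_at {W : ℝ → ℝ} {R B e κT CT D : ℝ} (hW : CutBounds W R B) (hκ0 : 0 ≤ κT) (hκ1 : κT ≤ 1)
    {N : ℕ} {y : Fin N → E3} (hs : Sep y) {j : Fin N} (hg : GoodAtScale (1 / 20) D y j) :
    CT - Dfl R B e ≤ surplusCap (1 / 20) (1 / 8) D W e κT CT N y j := by
  have h := siteEnergy_ge hW hs j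
  have hsite : (pairSumFeature W N y j - W 0) / 2 = siteEnergy W y j / 2 := by
    unfold pairSumFeature; rw [siteEnergy_eq]
  unfold surplusCap
  rw [hsite]
  unfold Dfl
  have hg1 := goodFlag_mem (η := 1 / 8) (D := D) y j
  have hflag : goodFlag (1 / 20) D N y j = 1 := by unfold goodFlag; rw [if_pos hg]
  rw [hflag]
  have h3 : κT * (1 - goodFlag (1 / 8) D N y j) ≤ 1 := by nlinarith
  nlinarith [le_abs_self e]

/-- ★ **TIGHT ABSORPTION at a general surcharge (PROVED)**: `0 ≤ κ_T ≤ 1`, `C ≥ C_T⁰(R,B,e,ρ)`, `ρ ≥ 0`: every ball containing a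
capped-tightly-good site has `S^D ≥ 0`. [folklore] -/
theorem tightAbsorptionCapAt {W : ℝ → ℝ} {R B e ρ κT CT D : ℝ} (hW : CutBounds W R B) (hρ : 0 ≤ ρ) (hκ0 : 0 ≤ κT) (hκ1 : κT ≤ 1)
    (hCT : CT₀ R B e ρ ≤ CT) {N : ℕ} {y : Fin N → E3} (hs : Sep y) {i : Fin N} (hT : TightNearCap ρ D y i) :
    0 ≤ ballAvg ρ y (surplusCap (1 / 20) (1 / 8) D W e κT CT N y) i := by
  obtain ⟨a, ha, hga⟩ := hT
  have hD : 0 ≤ Dfl R B e := (Dfl_pos hW.range_nonneg hW.floor_nonneg).le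
  have hDC := Dfl_le_CT₀ (e := e) hW.range_nonneg hW.floor_nonneg ρ
  have hCT0 : 0 ≤ CT := le_trans hD (hDC.trans hCT)
  have hM1 := one_le_Mball hρ
  have key := sum_div_ge_of_one_large (ball ρ y i) ha (surplusCap (1 / 20) (1 / 8) D W e κT CT N y)
    (fun j => ((ball ρ y j).card : ℝ)) (L := CT - Dfl R B e) (M := Mball ρ) (D := Dfl R B e) (by linarith) hD
    (fun j _ => by exact_mod_cast one_le_card_ball hρ y j) (card_ball_le hρ hs a) (card_ball_le hρ hs i)
    (fun j _ => surplusCap_ge_at hW hκ0 hκ1 hCT0 hs j) (surplusCap_ge_of_good_at hW hκ0 hκ1 hs hga)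
  have hMpos : 0 < Mball ρ := by linarith
  have hbound : Mball ρ * Dfl R B e ≤ (CT - Dfl R B e) / Mball ρ := by
    rw [le_div_iff₀ hMpos]
    unfold CT₀ at hCT
    nlinarith
  unfold ballAvg
  linarith

/-- In a capped-tight-free ball the allowance is invisible (any surcharge). [folklore] -/
theorem ballAvg_surplusCap_eq_of_not_tightNearCap_at {W : ℝ → ℝ} {e ρ κT CT D : ℝ} {N : ℕ} {y : Fin N → E3} {i : Fin N}
    (h : ¬TightNearCap ρ D y i) :
    ballAvg ρ y (surplusCap (1 / 20) (1 / 8) D W e κT CT N y) i = ballAvg ρ y (surplusCap (1 / 20) (1 / 8) D W e κT 0 N y) i := by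
  unfold ballAvg
  refine Finset.sum_congr rfl fun j hj => ?_
  have hng : ¬GoodAtScale (1 / 20) D y j := fun hg => h ⟨j, hj, hg⟩
  simp only [surplusCap, goodFlag, if_neg hng, mul_zero, add_zero]

/-- ★ **`TightFreeMotifPricingCapAt κ_T ρ ϱ D W e`** — the `C`-free family at surcharge `κ_T`: every injective `7/10`-separated radius-`ϱ` motif whose
centre's `ρ`-ball holds NO capped-tightly-good site has `S^D_centre(C = 0) ≥ 0`.  `…At (1/100)` is `TightFreeMotifPricingCap`; `…At 0` is the
UNSPLIT family. -/
def TightFreeMotifPricingCapAt (κT ρ ϱ D : ℝ) (W : ℝ → ℝ) (e : ℝ) : Prop :=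
  ∀ (M : ℕ) (z : Fin M → E3), Function.Injective z → Sep z → ∀ c : Fin M, (∀ a : Fin M, dist (z a) (z c) ≤ ϱ) →
    ¬TightNearCap ρ D z c → 0 ≤ ballAvg ρ z (surplusCap (1 / 20) (1 / 8) D W e κT 0 M z) c

/-- `TightFreeMotifPricingCapAt (1/100)` is the split family of `…TightFree`. [folklore] -/
theorem tightFreeMotifPricingCapAt_hundredth_iff {ρ ϱ D : ℝ} {W : ℝ → ℝ} {e : ℝ} :
    TightFreeMotifPricingCapAt (1 / 100) ρ ϱ D W e ↔ TightFreeMotifPricingCap ρ ϱ D W e :=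
  Iff.rfl

/-- ★ **`C ≥ C_T⁰ ∧ TightFreeMotifPricingCapAt κ_T ⟹ LAP^D on motifs at surcharge κ_T`** (`0 ≤ κ_T ≤ 1`, `ρ ≥ 0`). [folklore] -/
theorem ballAveragedMotifPricingCap_of_tightFreeAt {W : ℝ → ℝ} {R B e ρ ϱ κT CT D : ℝ} (hW : CutBounds W R B) (hρ : 0 ≤ ρ)
    (hκ0 : 0 ≤ κT) (hκ1 : κT ≤ 1) (hCT : CT₀ R B e ρ ≤ CT) (h : TightFreeMotifPricingCapAt κT ρ ϱ D W e) :
    BallAveragedMotifPricingCap ρ ϱ (1 / 20) (1 / 8) D W e κT CT := by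
  intro M z hz hs c hconf
  by_cases ht : TightNearCap ρ D z c
  · exact tightAbsorptionCapAt hW hρ hκ0 hκ1 hCT hs ht
  · rw [ballAvg_surplusCap_eq_of_not_tightNearCap_at ht]
    exact h M z hz hs c hconf ht

/-! ## §3. The shortest feed of column 27623 through the flat rule -/

/-- ★ **`FRG♭₄₅(−0.7174, C_T⁴⁵′(ρ)) ⟸ TightFreeMotifPricingCapAt 0 ρ ϱ D W₄₅ (−0.7174 + 3/400)`** (`0 ≤ ρ ≤ ρ₁`, `9/2 ≤ ρ₁`, `13/10·D + 1 ≤ ρ₁`,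
`ρ + ρ₁ ≤ ϱ`). [folklore chaining] -/
theorem schurRangeGap_fourHalf_of_tightFreeMotifCap_unsplit {ρ ρ₁ ϱ D : ℝ} (h0 : 0 ≤ ρ) (hρ : ρ ≤ ρ₁) (hR : 9 / 2 ≤ ρ₁)
    (hD : 13 / 10 * D + 1 ≤ ρ₁) (hϱ : ρ + ρ₁ ≤ ϱ)
    (h : TightFreeMotifPricingCapAt 0 ρ ϱ D (effPot w₄₅ ω₄ (3 / 400)) (-(7174 / 10000) + 3 / 400)) :
    SchurRangeGap w₄₅ ω₄ (3 / 400) (-(7174 / 10000)) (CT₀ (9 / 2) 1 (-(7174 / 10000) + 3 / 400) ρ) :=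
  schurRangeGap_of_ballAveragedMotifCap₀ (fun _ hr => effPot_fourHalf_eq_zero _ hr) (by norm_num) h0 hρ hR hD hϱ
    ((Dfl_pos W₄₅_cutBounds.range_nonneg W₄₅_cutBounds.floor_nonneg).le.trans
      (Dfl_le_CT₀ W₄₅_cutBounds.range_nonneg W₄₅_cutBounds.floor_nonneg ρ))
    (ballAveragedMotifPricingCap_of_tightFreeAt W₄₅_cutBounds h0 le_rfl (by norm_num) le_rfl h)

/-- ★★ **THE SHORTEST FEED — the crux `AperiodicFrustratedLawGap` (stmt-27623) BY NAME from the door, the Schur floor, the periodic ceiling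
and ONE finite `C`-free motif family, no elastic piece, no surcharge**:
`MuEquilibriumDoor ∧ SF₄₅ ∧ UP(−0.7175) ∧ TightFreeMotifPricingCapAt 0 ρ ϱ D W₄₅ (−0.7174 + 3/400) ⟹ AperiodicFrustratedLawGap`
(`0 ≤ ρ ≤ ρ₁`, `9/2 ≤ ρ₁`, `13/10·D + 1 ≤ ρ₁`, `ρ + ρ₁ ≤ ϱ`). [folklore chaining] -/
theorem aperiodicFrustratedLawGap_fourHalf_of_tightFreeMotifCap_unsplit {ρ ρ₁ ϱ D : ℝ}
    (hDoor : Summit.AtomisticToContinuum.Crystallization.Theses.GrainCoreNetworkSplit.MuEquilibriumDoor)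
    (hSF : SF₄₅) (hU : PeriodicEnergyCeiling (-(7175 / 10000)))
    (h0 : 0 ≤ ρ) (hρ : ρ ≤ ρ₁) (hR : 9 / 2 ≤ ρ₁) (hD : 13 / 10 * D + 1 ≤ ρ₁) (hϱ : ρ + ρ₁ ≤ ϱ)
    (h : TightFreeMotifPricingCapAt 0 ρ ϱ D (effPot w₄₅ ω₄ (3 / 400)) (-(7174 / 10000) + 3 / 400)) :
    Summit.AtomisticToContinuum.Crystallization.Theses.FrustratedLawDichotomy.AperiodicFrustratedLawGap :=
  aperiodicFrustratedLawGap_of_schurCut hDoor hSF hU (schurRangeGap_fourHalf_of_tightFreeMotifCap_unsplit h0 hρ hR hD hϱ h) (by norm_num)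

/-- **One-shell literal**: `ρ = 23/20`, `D = 3/2`, `ρ₁ = 9/2`, `ϱ = 113/20`. [folklore chaining] -/
theorem aperiodicFrustratedLawGap_fourHalf_of_tightFreeMotifCap_unsplit_oneShell
    (hDoor : Summit.AtomisticToContinuum.Crystallization.Theses.GrainCoreNetworkSplit.MuEquilibriumDoor)
    (hSF : SF₄₅) (hU : PeriodicEnergyCeiling (-(7175 / 10000)))
    (h : TightFreeMotifPricingCapAt 0 (23 / 20) (113 / 20) (3 / 2) (effPot w₄₅ ω₄ (3 / 400)) (-(7174 / 10000) + 3 / 400)) :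
    Summit.AtomisticToContinuum.Crystallization.Theses.FrustratedLawDichotomy.AperiodicFrustratedLawGap :=
  aperiodicFrustratedLawGap_fourHalf_of_tightFreeMotifCap_unsplit (ρ₁ := 9 / 2) hDoor hSF hU (by norm_num) (by norm_num) le_rfl (by norm_num)
    (by norm_num) h

/-- **The periodic sibling `PeriodicFrustratedLawGap` (stmt-27624) from the same unsplit family.** [folklore chaining] -/
theorem periodicFrustratedLawGap_fourHalf_of_tightFreeMotifCap_unsplit {ρ ρ₁ ϱ D : ℝ}
    (hDoor : Summit.AtomisticToContinuum.Crystallization.Theses.GrainCoreNetworkSplit.MuEquilibriumDoor)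
    (hSF : SF₄₅) (hU : PeriodicEnergyCeiling (-(7175 / 10000)))
    (h0 : 0 ≤ ρ) (hρ : ρ ≤ ρ₁) (hR : 9 / 2 ≤ ρ₁) (hD : 13 / 10 * D + 1 ≤ ρ₁) (hϱ : ρ + ρ₁ ≤ ϱ)
    (h : TightFreeMotifPricingCapAt 0 ρ ϱ D (effPot w₄₅ ω₄ (3 / 400)) (-(7174 / 10000) + 3 / 400)) :
    Summit.AtomisticToContinuum.Crystallization.Theses.FrustratedLawDichotomy.PeriodicFrustratedLawGap :=
  periodicFrustratedLawGap_of_schurCut hDoor hSF hU (schurRangeGap_fourHalf_of_tightFreeMotifCap_unsplit h0 hρ hR hD hϱ h) (by norm_num)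

/-- **Split feed with `C_T` free in the surcharge too**: `TightFreeMotifPricingCapAt κ_T` (`0 ≤ κ_T ≤ 1`) at level `e₄₅` gives `T′♭₄₅(κ_T, C_T⁴⁵(ρ))`.
[folklore chaining] -/
theorem schurTopologicalPricing_fourHalf_of_tightFreeMotifCapAt {κT ρ ρ₁ ϱ D : ℝ} (hκ0 : 0 ≤ κT) (hκ1 : κT ≤ 1) (h0 : 0 ≤ ρ) (hρ : ρ ≤ ρ₁)
    (hR : 9 / 2 ≤ ρ₁) (hD : 13 / 10 * D + 1 ≤ ρ₁) (hϱ : ρ + ρ₁ ≤ ϱ)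
    (h : TightFreeMotifPricingCapAt κT ρ ϱ D (effPot w₄₅ ω₄ (3 / 400)) (-(7175 / 10000) + 3 / 400)) :
    SchurTopologicalPricing (1 / 20) (1 / 8) w₄₅ ω₄ (3 / 400) (-(7175 / 10000)) κT (CT₀ (9 / 2) 1 (-(7175 / 10000) + 3 / 400) ρ) :=
  schurTopologicalPricing_of_ballAveragedMotifCap (fun _ hr => effPot_fourHalf_eq_zero _ hr) (by norm_num) (by norm_num) h0 hρ hR hD hϱ hκ0
    ((Dfl_pos W₄₅_cutBounds.range_nonneg W₄₅_cutBounds.floor_nonneg).le.trans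
      (Dfl_le_CT₀ W₄₅_cutBounds.range_nonneg W₄₅_cutBounds.floor_nonneg ρ))
    (ballAveragedMotifPricingCap_of_tightFreeAt W₄₅_cutBounds h0 hκ0 hκ1 le_rfl h)

end Summit.AtomisticToContinuum.Crystallization.Theorems.FrustratedLawDichotomyAveragingRuleUnsplit

end
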